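import Literature.MathematicalPhysics.QuantumFieldTheory.Balaban1983to89.B9Eq349BlockDistanceWeight
import Literature.MathematicalPhysics.QuantumFieldTheory.Balaban1983to89.B5G183FreeRowSum

/-!
# `Balaban1983to89.B9Eq342CoshWeightBlockDistance` — T. Bałaban, *Propagators for lattice gauge theories in a background field*, Commun. Math. Phys. **99**
# (1985) 389–434 [Balaban1985BackgroundPropagators] Thm 3.1 (3.42) p. 397 (decay factor `e^{−δ₀d(y,y′)}`), (3.49) p. 399; T. Bałaban, *Propagators and
# renormalization transformations for lattice gauge theories I*, Commun. Math. Phys. **95** (1984) 17–40 [Balaban1984PropagatorsI] p. 36 (the `cosh` weight):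
# **THE PRODUCT `cosh` WEIGHT AGAINST THE BLOCK DISTANCE — the inhabitants of the weight-domination letter `hW : e^{κ₁·d_m(u, π x)} ≤ M·W(x)` of
# `B9Eq342BlockDecayWeightedSum` §3: (i) MATCHED UNITS `e^{aL·d_m(π x₀, π x)} ≤ e^{a(L−1)}·e^{a·d_{Lm}(x₀,x)}`; (ii) `e^{a·d_P(x₀,x)} ≤ 2·Π_i cosh(a·ccoord_i(x₀,x))`
# (`d_P = tdist` is the sup of the circular coordinate distances); (iii) the OWNER's (D-MP) `B5Eq129CoshSupersolution` weight `Π_μ cosh(a·circAbs(P_μ)((c_μ − y_μ).val))`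
# centred at the coordinatewise cast `c = (x₀ᵢ mod Pᵢ)ᵢ` (`B9Eq315FlatDictionary.torCast_bijective`'s map), read at `(xᵢ mod Pᵢ)ᵢ`, IS `Π_i cosh(a·ccoord_i(x₀,x))`;
# hence (iv) such a weight inhabits `hW` with `κ₁ = aL`, `M = 2e^{a(L−1)}`** — [folklore] bookkeeping for storey (D) of the NE9 owner's SUP-NORM PROGRAMME (plan v10 §5)

statement-level skeleton of published theorems with citation tags; proofs where landed; nothing here is a claim about the Yang–Mills mass gap

CITATION HEADER (lean-in-tree rule).  Audit cell `pub-balaban`, sub-cell `t4`, BINDER row NE9; filed by NE9 formalisation-swarm LEAF PROVER 06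
(`b2b-balaban-t4-ne9-formalise-leaf-06`, gen 70) as the companion of `B9Eq342BlockDecayWeightedSum` ((D-E)).  Sources READ in the held texts: [Balaban1985BackgroundPropagators]
p. 397 Thm 3.1 (3.42) *«e^{−δ₀d(y,y′)} for x ∈ Δ(y), y ∈ Λ_j, supp λ ⊂ Δ(y′)»*, p. 399 (3.49) (blocks `Δ(y)` of `L^d` fine sites ⇒ fine distance vs block distance);
[Balaban1984PropagatorsI] p. 36 (exponential weights in the random-walk estimates; the cell's `cosh` product is `B5G183FreeRowSum`'s∕`B5Eq129CoshSupersolution`'s device —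
METHOD: Agmon∕Combes–Thomas weights, textbook).  NOTHING printed is asserted; the letters `mul_tdist_blockCoord_sub_le_tdist` (ne9-leaf-01, `B9Eq349BlockDistanceWeight`),
`ccoord`∕`tdist` (b04 `B4Sect5Torus`) and `circAbs_val_eq` (pv15 `B5G183FreeRowSum`) are USED BY NAME.

WHAT IS PROVED (sorry-free; proof lane — no `def`; [folklore]).
* `exp_mul_tdist_blockCoord_le` — (i); `exp_mul_tdist_le_two_mul_prod_cosh` — (ii) (one factor `cosh t ≥ e^t∕2` at the maximising coordinate, the others `≥ 1`; `d = 0`: `1 ≤ 2`);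
  `circAbs_torCast_sub_val_eq_ccoord`, `prod_cosh_torCast_eq`, `exp_mul_tdist_le_two_mul_weight_torCast` — (iii); `exp_blockDist_le_weight_of_prod_cosh`,
  `exp_blockDist_le_weight_of_fine` — (iv) (`Π_i cosh(a·ccoord_i(x₀,x)) ≤ M_W·W x` resp. `e^{a·d_{Lm}(x₀,x)} ≤ M₀·W x` ⟹ `e^{aL·d_m(πx₀,πx)} ≤ e^{a(L−1)}(2M_W)·W x` resp.
  `e^{a(L−1)}M₀·W x`).
HONEST SCOPE.  Distance bookkeeping on the discrete torus; no operator of the paper; the weight's SUPERSOLUTION property is (D-MP)'s, not used here.  NOT NE9 (cell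
pub-balaban: NE9 NOT PRINTED ∕ NOT PROVED; «NE9 ⇐ the named binders»; row WALLED ON A MODEL (O-NE9-1; #5 UNRULED); spine PROVED 0∕9; rung (B)+1 on a finite T⁴ — NOT
infinite volume, NOT mass gap, NOT Clay; HONEST DEPENDENCY: continuum YM on T⁴ ⇐ BetaPertH ∧ nine spine estimates (0/9 proved); BetaPertH ⇐ (D1) ∧ (D4) ∧ CAP+tail;
G-an2-4 gates asym, D1 and NE2/3/4).  NEW file importing `B9Eq349BlockDistanceWeight` and `B5G183FreeRowSum`; nothing modified.  Net new unproved facts: 0.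
-/

noncomputable section

open scoped BigOperators

namespace Literature.MathematicalPhysics.QuantumFieldTheory.Balaban1983to89.B9Eq342CoshWeightBlockDistance

open B4Sect5Torus (TSite tdist ccoord ccoord_cast tdist_nonneg)
open B9Eq319QprimeTorus (fineP blockCoord)
open B9Eq349BlockDistanceWeight (mul_tdist_blockCoord_sub_le_tdist)
open B4TorusKernel.MultiPeriod (circAbs)
open B5G183FreeRowSum (circAbs_val_eq)

variable {d : ℕ} {L : ℕ} {m : Fin d → ℕ}

/-- **MATCHED UNITS**: `e^{a·L·d_m(π x₀, π x)} ≤ e^{a(L−1)}·e^{a·d_{Lm}(x₀, x)}` (`0 ≤ a`) — a weight growing like `e^{a·d_{Lm}(x₀,·)}` in FINE-site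
units dominates the block-distance exponential at rate `aL` (from `L·d_m(π x, π x′) − (L−1) ≤ d_{Lm}(x, x′)`). [folklore]
[cite: Balaban1985Averaging, (2) p.17; Balaban1985BackgroundPropagators, (3.49) p.399] -/
theorem exp_mul_tdist_blockCoord_le [NeZero L] (hm : ∀ i, 1 ≤ m i) {a : ℝ} (ha : 0 ≤ a) (x₀ x : TSite d (fineP L m)) :
    Real.exp (a * (L : ℝ) * tdist m (blockCoord L m x₀) (blockCoord L m x)) ≤
      Real.exp (a * ((L : ℝ) - 1)) * Real.exp (a * tdist (fineP L m) x₀ x) := by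
  rw [← Real.exp_add]
  apply Real.exp_le_exp.mpr
  have h := mul_tdist_blockCoord_sub_le_tdist (L := L) hm x₀ x
  nlinarith [h, ha]

/-- **THE PRODUCT `cosh` WEIGHT DOMINATES THE SUP-DISTANCE EXPONENTIAL**: `e^{a·d_P(x₀,x)} ≤ 2·Π_i cosh(a·d_i(x₀,x))` with `d_i = ccoord` the circular
coordinate distances (`d_P = max_i d_i`; one factor `cosh t ≥ e^t∕2`, the others `≥ 1`; `d = 0`: `1 ≤ 2`) — the weight of the OWNER's (D-MP)
`B5Eq129CoshSupersolution` read in `TSite` coordinates gives `M₀ = 2` below. [folklore] [cite: Balaban1984PropagatorsI, p.36; Balaban1985BackgroundPropagators, Thm 3.1 (3.42) p.397] -/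
theorem exp_mul_tdist_le_two_mul_prod_cosh {P : Fin d → ℕ} (a : ℝ) (x₀ x : TSite d P) :
    Real.exp (a * tdist P x₀ x) ≤ 2 * ∏ i, Real.cosh (a * (ccoord P x₀ x i : ℝ)) := by
  have hone : ∀ i, 1 ≤ Real.cosh (a * (ccoord P x₀ x i : ℝ)) := fun i => Real.one_le_cosh _
  have hprod1 : 1 ≤ ∏ i, Real.cosh (a * (ccoord P x₀ x i : ℝ)) := Finset.one_le_prod fun i _ => hone i
  rcases Nat.eq_zero_or_pos d with hd | hd
  · subst hd
    have h0 : tdist P x₀ x = 0 := by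
      unfold tdist; rw [Finset.univ_eq_empty, Finset.sup_empty]; simp
    rw [h0, mul_zero, Real.exp_zero]
    linarith
  · have hne : (Finset.univ : Finset (Fin d)).Nonempty := Finset.univ_nonempty_iff.mpr ⟨⟨0, hd⟩⟩
    obtain ⟨i, -, hi⟩ := Finset.exists_mem_eq_sup Finset.univ hne (ccoord P x₀ x)
    have ht : tdist P x₀ x = (ccoord P x₀ x i : ℝ) := by unfold tdist; rw [hi]
    rw [ht]
    have hcosh : Real.exp (a * (ccoord P x₀ x i : ℝ)) ≤ 2 * Real.cosh (a * (ccoord P x₀ x i : ℝ)) := by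
      rw [Real.cosh_eq]
      have := Real.exp_pos (-(a * (ccoord P x₀ x i : ℝ)))
      linarith
    have hsplit : ∏ j, Real.cosh (a * (ccoord P x₀ x j : ℝ)) =
        Real.cosh (a * (ccoord P x₀ x i : ℝ)) * ∏ j ∈ Finset.univ.erase i, Real.cosh (a * (ccoord P x₀ x j : ℝ)) :=
      (Finset.mul_prod_erase Finset.univ (fun j => Real.cosh (a * (ccoord P x₀ x j : ℝ))) (Finset.mem_univ i)).symm
    have h1 : 1 ≤ ∏ j ∈ Finset.univ.erase i, Real.cosh (a * (ccoord P x₀ x j : ℝ)) := Finset.one_le_prod fun j _ => hone j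
    have h0 : 0 ≤ Real.cosh (a * (ccoord P x₀ x i : ℝ)) := (Real.cosh_pos _).le
    rw [hsplit]
    nlinarith

/-- **THE (D-MP) WEIGHT READ IN `TSite` COORDINATES, per coordinate**: `circAbs(P_i)(((x₀ᵢ mod Pᵢ) − (xᵢ mod Pᵢ)).val) = ccoord_i(x₀,x)` — the coordinatewise
cast `x ↦ (xᵢ mod Pᵢ)ᵢ : TSite d P → Tor P` of `B9Eq315FlatDictionary.torCast_bijective` carries `B5Eq129CoshSupersolution`'s weight factors onto `B4Sect5Torus.ccoord`
(`circAbs_val_eq` + `ccoord_cast`). [folklore] [cite: Balaban1984PropagatorsI, p.36; Balaban1985BackgroundPropagators, (3.49) p.399] -/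
theorem circAbs_torCast_sub_val_eq_ccoord {P : Fin d → ℕ} [∀ i, NeZero (P i)] (x₀ x : TSite d P) (i : Fin d) :
    circAbs (P i) (((((x₀ i : ℕ) : ZMod (P i)) - ((x i : ℕ) : ZMod (P i))).val : ℕ) : ℤ) = (ccoord P x₀ x i : ℤ) := by
  have hP1 : ∀ i, 1 ≤ P i := fun i => Nat.one_le_iff_ne_zero.mpr (NeZero.ne (P i))
  rw [ccoord_cast hP1 x₀ x i]
  refine circAbs_val_eq _ _ ?_
  push_cast
  rfl

/-- … hence **THE (D-MP) PRODUCT `cosh` WEIGHT CENTRED AT `(x₀ᵢ mod Pᵢ)ᵢ`, EVALUATED AT `(xᵢ mod Pᵢ)ᵢ`, IS `Π_i cosh(a·ccoord_i(x₀,x))`**. [folklore]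
[cite: Balaban1984PropagatorsI, p.36; Balaban1985BackgroundPropagators, Thm 3.1 (3.42) p.397] -/
theorem prod_cosh_torCast_eq {P : Fin d → ℕ} [∀ i, NeZero (P i)] (a : ℝ) (x₀ x : TSite d P) :
    ∏ i, Real.cosh (a * (circAbs (P i) (((((x₀ i : ℕ) : ZMod (P i)) - ((x i : ℕ) : ZMod (P i))).val : ℕ) : ℤ) : ℝ)) =
      ∏ i, Real.cosh (a * (ccoord P x₀ x i : ℝ)) := by
  refine Finset.prod_congr rfl fun i _ => ?_
  rw [circAbs_torCast_sub_val_eq_ccoord x₀ x i, Int.cast_natCast]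

/-- … hence **THE (D-MP) WEIGHT IN ITS OWN (`Tor`) SPELLING DOMINATES THE SUP-DISTANCE EXPONENTIAL**: `e^{a·d_P(x₀,x)} ≤ 2·Π_i cosh(a·circAbs(P_i)(((x₀ᵢ mod Pᵢ) −
(xᵢ mod Pᵢ)).val))` — so `B5Eq129CoshSupersolution`'s `W_c` with `c = (x₀ᵢ mod Pᵢ)ᵢ` inhabits `exp_blockDist_le_weight_of_prod_cosh`'s premise with `M_W = 1` after
`prod_cosh_torCast_eq`. [folklore] [cite: Balaban1984PropagatorsI, p.36; Balaban1985BackgroundPropagators, Thm 3.1 (3.42) p.397] -/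
theorem exp_mul_tdist_le_two_mul_weight_torCast {P : Fin d → ℕ} [∀ i, NeZero (P i)] (a : ℝ) (x₀ x : TSite d P) :
    Real.exp (a * tdist P x₀ x) ≤ 2 * ∏ i, Real.cosh (a * (circAbs (P i) (((((x₀ i : ℕ) : ZMod (P i)) - ((x i : ℕ) : ZMod (P i))).val : ℕ) : ℤ) : ℝ)) := by
  rw [prod_cosh_torCast_eq a x₀ x]
  exact exp_mul_tdist_le_two_mul_prod_cosh a x₀ x

/-- … hence **THE PRODUCT `cosh` WEIGHT IN FINE-SITE UNITS INHABITS `hW` AT RATE `aL` WITH `M = 2e^{a(L−1)}·M_W`**: if `Π_i cosh(a·d_i(x₀,x)) ≤ M_W·W(x)`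
(`0 ≤ a`; `M_W = 1` for the weight itself), then `e^{aL·d_m(π x₀, π x)} ≤ (e^{a(L−1)}·(2M_W))·W(x)`. [folklore]
[cite: Balaban1985Averaging, (2) p.17; Balaban1984PropagatorsI, p.36; Balaban1985BackgroundPropagators, Thm 3.1 (3.42) p.397] -/
theorem exp_blockDist_le_weight_of_prod_cosh [NeZero L] (hm : ∀ i, 1 ≤ m i) {a : ℝ} (ha : 0 ≤ a) (x₀ : TSite d (fineP L m))
    {W : TSite d (fineP L m) → ℝ} {MW : ℝ}
    (hW : ∀ x, ∏ i, Real.cosh (a * (ccoord (fineP L m) x₀ x i : ℝ)) ≤ MW * W x) (x : TSite d (fineP L m)) :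
    Real.exp (a * (L : ℝ) * tdist m (blockCoord L m x₀) (blockCoord L m x)) ≤ Real.exp (a * ((L : ℝ) - 1)) * (2 * MW) * W x := by
  have hfine : ∀ x, Real.exp (a * tdist (fineP L m) x₀ x) ≤ 2 * MW * W x := fun x =>
    calc Real.exp (a * tdist (fineP L m) x₀ x) ≤ 2 * ∏ i, Real.cosh (a * (ccoord (fineP L m) x₀ x i : ℝ)) :=
          exp_mul_tdist_le_two_mul_prod_cosh a x₀ x
      _ ≤ 2 * (MW * W x) := mul_le_mul_of_nonneg_left (hW x) zero_le_two
      _ = 2 * MW * W x := by ring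
  calc Real.exp (a * (L : ℝ) * tdist m (blockCoord L m x₀) (blockCoord L m x))
      ≤ Real.exp (a * ((L : ℝ) - 1)) * Real.exp (a * tdist (fineP L m) x₀ x) := exp_mul_tdist_blockCoord_le hm ha x₀ x
    _ ≤ Real.exp (a * ((L : ℝ) - 1)) * (2 * MW * W x) := mul_le_mul_of_nonneg_left (hfine x) (Real.exp_pos _).le
    _ = Real.exp (a * ((L : ℝ) - 1)) * (2 * MW) * W x := by ring

/-- **A FINE-SITE EXPONENTIAL WEIGHT INHABITS THE BLOCK-DISTANCE DOMINATION LETTER `hW`**: if `e^{a·d_{Lm}(x₀,x)} ≤ M₀·W(x)` for all fine sites `x`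
(`0 ≤ a`; e.g. a product `Π_μ cosh(a·d_μ(x₀,x))` with `M₀ = 2`), then `e^{(aL)·d_m(π x₀, π x)} ≤ (e^{a(L−1)}·M₀)·W(x)` — the shape consumed by
`norm_block_apply_le_weight_lattice` ∕ `weighted_sum_norm_sq_le_of_block_decay_lattice` with `κ₁ = aL`, `u = π x₀`. [folklore]
[cite: Balaban1985Averaging, (2) p.17; Balaban1985BackgroundPropagators, Thm 3.1 (3.42) p.397] -/
theorem exp_blockDist_le_weight_of_fine [NeZero L] (hm : ∀ i, 1 ≤ m i) {a : ℝ} (ha : 0 ≤ a) (x₀ : TSite d (fineP L m))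
    {W : TSite d (fineP L m) → ℝ} {M₀ : ℝ} (hW : ∀ x, Real.exp (a * tdist (fineP L m) x₀ x) ≤ M₀ * W x)
    (x : TSite d (fineP L m)) :
    Real.exp (a * (L : ℝ) * tdist m (blockCoord L m x₀) (blockCoord L m x)) ≤ Real.exp (a * ((L : ℝ) - 1)) * M₀ * W x :=
  calc Real.exp (a * (L : ℝ) * tdist m (blockCoord L m x₀) (blockCoord L m x))
      ≤ Real.exp (a * ((L : ℝ) - 1)) * Real.exp (a * tdist (fineP L m) x₀ x) := exp_mul_tdist_blockCoord_le hm ha x₀ x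
    _ ≤ Real.exp (a * ((L : ℝ) - 1)) * (M₀ * W x) := mul_le_mul_of_nonneg_left (hW x) (Real.exp_pos _).le
    _ = Real.exp (a * ((L : ℝ) - 1)) * M₀ * W x := by ring

end Literature.MathematicalPhysics.QuantumFieldTheory.Balaban1983to89.B9Eq342CoshWeightBlockDistance

end

-- comment-only re-land 2026-08-24 (ne9-leaf-06 g72): forces the olean build of this casualty of the 2026-08-23 ENOSPC incident
-- (accepted 2026-08-23, never built; ops BUILD-ENQUEUE-bf3g18-casualties); every declaration above is byte-identical to the accepted file.
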